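/-
Copyright: lit-balaban cell (HOME `run/shared/lean/pub/lit-balaban/`), Phase-2 proof seat p12 (gen 14).  Statement-level record of
a published text; nothing is claimed beyond what the kernel checks below.
-/
import Literature.MathematicalPhysics.QuantumFieldTheory.FariaDaVeigaOCarroll2022.FdVOC22MultiReflectionBound
import Literature.MathematicalPhysics.QuantumFieldTheory.FariaDaVeigaOCarroll2022.FdVOC22PeriodicAndFreeEnergyBounds
import HarnessLib

/-!
# `FariaDaVeigaOCarroll2022.FdVOC22GeneratingFunctionBound` — P. A. Faria da Veiga, M. O'Carroll, *On Yang–Mills stability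
# bounds and plaquette field generating function*, arXiv:2205.07376 (Rep. Math. Phys. **95** (2025) 303–380)
# [FariaDaVeigaOCarroll2022YMStability]: **THEOREM 4, first item (Gb)** — the `r`-plaquette scaled-field generating function of
# the periodic `U(N)` Wilson model is bounded, `|G_{r,Λ,a}(J^{(r)})| ≤ ∏_j |z_u(rJ_j)|^{2^dΛ_r/(rΛ_s)} z_ℓ^{−2^d(Λ_r+Λ_e)/(rΛ_s)}`
# — PROVED on the tree's carriers, on top of `FdVOC22MultiReflectionBound` (the §6.5 chessboard step) and
# `FdVOC22PeriodicAndFreeEnergyBounds` (Theorem 1, periodic b.c.)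

statement-level skeleton of published theorems with citation tags; proofs where landed; nothing here is a claim about
the Yang–Mills mass gap

Source held: `paper:arxiv-2205.07376` (corpus-tex layer; page = chunk `pNNNN`, `L` = line).  Unit `lit-balaban-p12` (gen 14),
free-target protocol G.5-34(d); context row X2 of the cell's `YM-INPRINT.md`.  Companion of `FdVOC22StabilityBounds` /
`FdVOC22PeriodicAndFreeEnergyBounds` (same namespace: `pw`, `zu`, `zl`, `ZP`, `partner`, `zl_pow_le_ZP` are those files') and of
`FdVOC22MultiReflectionBound` (`blockSite`, `integral_plaquette_le_rpow_of_one_le`, `integral_plaquette_eq_of_symmetry`).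

WHAT IS PRINTED.  p0016: «define the gauge-invariant scaled plaquette field by (Mmunu) `M_{μν}(x) = (a^{d−4}/g²)^{1/2}(U_p − 1)`»;
«The `r`-plaquette scaled field generating function … is defined by `G_{r,Λ,a}(J^{(r)}) = (1/Z^P_{Λ,a}) Z^P_{r,Λ,a}(J^{(r)})`, where
`Z^P_{r,Λ,a}(J^{(r)})` is defined similarly to `Z^P_{Λ,a}` (see Eq. (part)), but with the inclusion of `r` local source factors in
the integrand given by `exp[Σ_{1≤j≤r} J_j(x_j) tr M_{p_j}(U_{p_j})]`»; **Theorem 4** «Considering the model with periodic b.c., we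
have: • The `r`-plaquette scaled field generating function is bounded by (Gb) `|G_{r,Λ,a}(J^{(r)})| ≤ ∏_{1≤j≤r}
|z_u(rJ_j)|^{2^dΛ_r/(rΛ_s)} z_ℓ^{−2^d(Λ_r+Λ_e)/(rΛ_s)}` • From this, if `G_{r,a}(J^{(r)})` denotes a sequential or subsequential
thermodynamic limit `Λ → aℤ^d`, then `|G_{r,a}(J^{(r)})| ≤ ∏_j |z_u(rJ_j)/z_ℓ|^{2^d(d−1)/r}`, with (Gb2) `|z_u(J)| = ∫ exp[|J|
(a^{d−4}/g²)^{1/2} |Tr(U−1)| − (a^{d−4}/g²) A_p(U)] dσ(U)` …».  p0019, §6.5 (proof): «first use the generalized Hölder's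
inequality … `|G_{r,Λ,a}(J^{(r)})| ≤ ∏_j |G_{1,Λ,a}(rJ_j)|^{1/r}`.  … we use the π/2 lattice rotational symmetry and translational
symmetry to put the single plaquette in the μν = 01 coordinate plane … Then, we apply the multi-reflection method to obtain the
bound `|G_{1,Λ,a}(rJ_j)| ≤ |G_{Λ,a}(rJ_j)|^{2^d/Λ_s}` … The source factor is given by `exp[J Σ'_p tr M_p(U_p)]`, where the sum is
over an array of plaquettes … We obtain a greater upper bound by noting that `|J tr M_p(U_p)| ≤ |J| [a^{(d−4)/2}/g] |tr(U_p −
1)|` … We also increase the bound by summing over all plaquettes in the lattice Λ that are parallel to the 01 coordinate plane …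
we discard plaquette actions in `A^P`, for plaquettes that are not in Λ … We bound the integral as we did for the upper stability
bound for the free b.c. case. In this manner, we obtain the factorized bound `|Z^P_{Λ,a}(J)| ≤ [z_u(J)]^{Λ_r}` … Here, we have
used the factorized lower bound of Theorems 1 and 2 for `Z^P_{Λ,a}`.»

WHAT IS PROVED (0 sorry, no new `def … : Prop`), in the tree's currency `β = 2a^{d−4}/g² = 2γ` of `FdVOC22StabilityBounds` (so
`γ^{1/2} = √(β/2) = sqrtGamma β`), for `U(N)`, every `d ≥ 2`, every torus side `L = 2M` with `M` even and every `β ≥ 0`: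
§1 the source: `trM` = `tr M_p` of (Mmunu), the source weight `srcWeight N β s U = exp[s γ^{1/2} |tr(U − 1)|]`, and **`zuJ`** =
(Gb2) line 1, `|z_u(J)| = ∫ exp[|J| γ^{1/2}|Tr(U−1)| − γ A_p(U)] dσ(U)` (`zuJ_eq`); §2 the §6.2 successive bond integrations of
`FdVOC22StabilityBounds` for a GENERAL single-plaquette weight (`lintegral_prodPartnerWt_eq`: `∫ ∏_{e∈T} w(U_{partner e}) dσ^{E} =
(∫ w dσ)^{#T}`); §3 the array of the multi-reflection method on EVEN corners (one `0,(d−1)`-plaquette per block of side 2; each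
array plaquette is the partner plaquette of a free bond, `partner_arrayEdge`); §4 **`lintegral_cube_src_le`** = «`|Z_{Λ,a}(J)| ≤
[z_u(J)]^{Λ_r}`» for the cube with sources on the array, and §5 **`integral_prod_srcWeight_le`**: the torus expectation of the
array source is `≤ z_u(J)^{Λ_r} / z_ℓ^{Λ_r+Λ_e}` («we discard plaquette actions … for plaquettes that are not in Λ», `ZP ≤`
cube, and `zl_pow_le_ZP`); §6 **`genFun`** = `G_{r,Λ,a}(J^{(r)})` as the normalized torus Wilson expectation of `exp[Σ_j J_j tr
M_{p_j}]` (`genFun_eq_div`: `= Z^P_r(J)/Z^P`), the generalized Hölder step **`norm_genFun_le`**, and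
**`theorem4_generating_function_bound`** = (Gb): `‖G_{r,Λ,a}(J)‖ ≤ ∏_j (zuJ(r|J_j|)^{Λ_r} / zl^{Λ_r+Λ_e})^{1/(r M^d)}`
with `1/M^d = 2^d/Λ_s` (`Λ_s = L^d = 2^d M^d`), `Λ_r = #E^1_L` (`freeEdges`), `Λ_r + Λ_e = dL^d − (L^d − 1)`
(`card_freeEdges_add_closing`), for every `r`, every family of plaquettes `p_j` and all (complex) source strengths `J_j`, and
**`theorem4_generating_function_bound_printed`** = (Gb) with the exponents AS PRINTED, `∏_j |z_u(rJ_j)|^{2^dΛ_r/(rΛ_s)}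
z_ℓ^{−2^d(Λ_r+Λ_e)/(rΛ_s)}`.

Precision recorded, not claimed beyond the print: (i) as in `FdVOC22MultiReflectionBound`, the block-2 array of the
multi-reflection method needs `L ≡ 0 (mod 4)` (`M` even); (ii) `|Tr(U − 1)|` of (Gb2) is read as the modulus of the complex
number `tr U − N` (the chain «`|J tr M_p| ≤ |J| γ^{1/2} |Im tr(U_p − 1)| ≤ |J| γ^{1/2} |tr(U_p − 1)|`» of §6.5), and `z_ℓ` is the
tree's Frobenius-currency `zl` of `FdVOC22StabilityBounds` (which is `≥` the printed Weyl-chamber integral, so (Gb) with the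
tree's `zl` implies (Gb) as printed); (iii) the second item of Theorem 4 (thermodynamic limit points) is the exponent count
«`Λ_s = L^d`, `Λ_r ≃ (d−1)L^d`, `Λ_e = dL^{d−1}`» applied to (Gb) and is not restated; the explicit evaluation/upper bound of
`|z_u(J)|` in (Gb2) lines 2–4 (Weyl integration formula) is not used by (Gb) and not formalized here.
-/

noncomputable section

open scoped Matrix.Norms.Frobenius ENNReal
open MeasureTheory Measure Finset Function
open Literature.Probability.LatticeModels Literature.MathematicalPhysics.QuantumLattice
open Literature.Barriers.CriticalPhenomena.NonGibbs

namespace Literature.MathematicalPhysics.QuantumFieldTheory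

namespace FariaDaVeigaOCarroll2022

open UnitaryCayley AxialGauge WilsonWeakCoupling

variable {d N : ℕ}

/-- Matrices `M_N(ℂ)` with the Frobenius (= Hilbert–Schmidt) norm. -/
local notation "𝕄" => Matrix (Fin N) (Fin N) ℂ

/-- Sites of `ℤ^d`. -/
local notation "ZSite" => Literature.Probability.LatticeModels.Site

/-- The defining representation of `U(N)`. -/
local notation "ρN" => unitaryFundamentalRep (Fin N) ℂ

/-! ## §1. The scaled plaquette field source and `|z_u(J)|` -/

/-- `γ^{1/2} = (a^{d−4}/g²)^{1/2}` in the tree's currency `β = 2a^{d−4}/g² = 2γ`: `γ^{1/2} = √(β/2)` (the scaling factor of the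
plaquette field, (Mmunu)). [cite: FariaDaVeigaOCarroll2022YMStability, (Mmunu) (chunk p0016)] -/
def sqrtGamma (β : ℝ) : ℝ := Real.sqrt (β / 2)

/-- `γ^{1/2} ≥ 0`. [cite: FariaDaVeigaOCarroll2022YMStability, (Mmunu) (chunk p0016)] -/
theorem sqrtGamma_nonneg (β : ℝ) : 0 ≤ sqrtGamma β := Real.sqrt_nonneg _

/-- `(γ^{1/2})² = γ = β/2` for `β ≥ 0`. [cite: FariaDaVeigaOCarroll2022YMStability, (Mmunu) (chunk p0016)] -/
theorem sqrtGamma_sq {β : ℝ} (hβ : 0 ≤ β) : sqrtGamma β ^ 2 = β / 2 :=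
  Real.sq_sqrt (by linarith)

variable (N) in
/-- **(Mmunu)**, traced: `tr M_p(U_p) = (a^{d−4}/g²)^{1/2} tr(U_p − 1) = γ^{1/2} (tr U_p − N)` for `U_p ∈ U(N)` — the
gauge-invariant scaled plaquette field of the generating function (a complex number).
[cite: FariaDaVeigaOCarroll2022YMStability, (Mmunu) (chunk p0016)] -/
def trM (β : ℝ) (U : 𝔾 N) : ℂ := (sqrtGamma β : ℂ) * ((U : 𝕄).trace - N)

/-- `|tr M_p(U)| = γ^{1/2} |tr(U − 1)|`. [cite: FariaDaVeigaOCarroll2022YMStability, §6.5 (chunk p0019)] -/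
theorem norm_trM (β : ℝ) (U : 𝔾 N) : ‖trM N β U‖ = sqrtGamma β * ‖(U : 𝕄).trace - N‖ := by
  rw [trM, norm_mul, Complex.norm_real, Real.norm_of_nonneg (sqrtGamma_nonneg β)]

variable (N) in
/-- The source weight of strength `s = |J|` on one plaquette: `exp[|J| (a^{d−4}/g²)^{1/2} |tr(U − 1)|]` (the bound «`|J tr
M_p(U_p)| ≤ |J| [a^{(d−4)/2}/g] |tr(U_p − 1)|`» of §6.5, exponentiated). [cite: FariaDaVeigaOCarroll2022YMStability, §6.5 (chunk p0019); (Gb2) (p0016)] -/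
def srcWeight (β s : ℝ) (U : 𝔾 N) : ℝ := Real.exp (s * (sqrtGamma β * ‖(U : 𝕄).trace - N‖))

/-- The source weight is positive. [cite: FariaDaVeigaOCarroll2022YMStability, §6.5 (chunk p0019)] -/
theorem srcWeight_pos (β s : ℝ) (U : 𝔾 N) : 0 < srcWeight N β s U := Real.exp_pos _

/-- `1 ≤ exp[s γ^{1/2}|tr(U−1)|]` for `s ≥ 0` («We also increase the bound by summing over all plaquettes … parallel to the 01
coordinate plane»: inserting a source factor never decreases the integrand). [cite: FariaDaVeigaOCarroll2022YMStability, §6.5 (chunk p0019)] -/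
theorem one_le_srcWeight (β : ℝ) {s : ℝ} (hs : 0 ≤ s) (U : 𝔾 N) : 1 ≤ srcWeight N β s U :=
  Real.one_le_exp (mul_nonneg hs (mul_nonneg (sqrtGamma_nonneg β) (norm_nonneg _)))

/-- The trace is continuous on `U(N)`. [folklore] -/
private theorem continuous_trace_coe : Continuous fun U : 𝔾 N => (U : 𝕄).trace :=
  continuous_subtype_val.matrix_trace

/-- The source weight is continuous on `U(N)`. [cite: FariaDaVeigaOCarroll2022YMStability, §6.5 (chunk p0019)] -/
theorem continuous_srcWeight (β s : ℝ) : Continuous (srcWeight N β s) := by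
  unfold srcWeight
  exact Real.continuous_exp.comp (continuous_const.mul (continuous_const.mul
    (continuous_norm.comp (continuous_trace_coe.sub continuous_const))))

/-- The source weight is bounded on the compact group `U(N)`. [cite: FariaDaVeigaOCarroll2022YMStability, §6.5 (chunk p0019)] -/
theorem exists_srcWeight_le (β s : ℝ) : ∃ K : ℝ, ∀ U : 𝔾 N, |srcWeight N β s U| ≤ K := by
  obtain ⟨U₀, -, hU₀⟩ := isCompact_univ.exists_isMaxOn Set.univ_nonempty (continuous_srcWeight (N := N) β s).continuousOn
  exact ⟨srcWeight N β s U₀, fun U => by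
    rw [abs_of_pos (srcWeight_pos β s U)]; exact hU₀ (Set.mem_univ U)⟩

/-- The source weight is a class function: `tr(h U h⁻¹) = tr U`. [cite: FariaDaVeigaOCarroll2022YMStability, §6.5 (chunk p0019)] -/
theorem srcWeight_conj (β s : ℝ) (U h : 𝔾 N) : srcWeight N β s (h * U * h⁻¹) = srcWeight N β s U := by
  unfold srcWeight
  congr 4
  rw [Matrix.UnitaryGroup.mul_val, Matrix.UnitaryGroup.mul_val, Matrix.UnitaryGroup.inv_val, Matrix.trace_mul_cycle,
    Matrix.UnitaryGroup.star_mul_self, one_mul]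

/-- The source weight is inversion invariant: `tr U⁻¹ = tr U† = conj(tr U)` and `|conj z − N| = |z − N|`.
[cite: FariaDaVeigaOCarroll2022YMStability, §6.5 (chunk p0019)] -/
theorem srcWeight_inv (β s : ℝ) (U : 𝔾 N) : srcWeight N β s U⁻¹ = srcWeight N β s U := by
  unfold srcWeight
  congr 3
  rw [Matrix.UnitaryGroup.inv_val, Matrix.star_eq_conjTranspose, Matrix.trace_conjTranspose, Complex.star_def,
    ← Complex.norm_conj ((U : 𝕄).trace - N), map_sub, map_natCast]

/-- The single-plaquette Boltzmann weight `w_β` is measurable. [folklore] -/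
private theorem measurable_pw' (β : ℝ) : Measurable (pw N β) :=
  ENNReal.measurable_ofReal.comp (Real.measurable_exp.comp
    ((measurable_const.sub (Complex.continuous_re.comp continuous_trace_coe).measurable).const_mul (-β)))

variable (N) in
/-- **(Gb2), first line**: the single-bond partition function WITH SOURCE, `|z_u(J)| = ∫ exp[|J| (a^{d−4}/g²)^{1/2} |Tr(U − 1)| −
(a^{d−4}/g²) A_p(U)] dσ(U)`, as a function of the source strength `s = |J|`: `∫ exp[s γ^{1/2}|tr(U−1)|] w_β(U) dσ(U)` with
`w_β(U) = exp[−β(N − Re tr U)] = exp[−γ A_p(U)]` (see `zuJ_eq`). [cite: FariaDaVeigaOCarroll2022YMStability, Theorem 4 (Gb2) (chunk p0016)] -/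
def zuJ (β s : ℝ) : ℝ≥0∞ := ∫⁻ U, ENNReal.ofReal (srcWeight N β s U) * pw N β U ∂haarProbability (𝔾 N)

/-- `|z_u(J)|` as printed: one exponential `exp[s γ^{1/2}|tr(U − 1)| − β(N − Re tr U)]`, `β(N − Re tr U) = γ‖U − 1‖²_{H-S} =
γ A_p(U)`. [cite: FariaDaVeigaOCarroll2022YMStability, Theorem 4 (Gb2) (chunk p0016)] -/
theorem zuJ_eq (β s : ℝ) : zuJ N β s = ∫⁻ U, ENNReal.ofReal (Real.exp
      (s * (sqrtGamma β * ‖(U : 𝕄).trace - N‖) - β * ((N : ℝ) - ((U : 𝕄).trace).re))) ∂haarProbability (𝔾 N) := by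
  refine lintegral_congr fun U => ?_
  rw [srcWeight, pw, ← ENNReal.ofReal_mul (Real.exp_pos _).le, ← Real.exp_add, neg_mul, ← sub_eq_add_neg]

/-- Without source `|z_u(0)| = z_u`. [cite: FariaDaVeigaOCarroll2022YMStability, Theorem 4 (Gb2) / Theorem 1 (zu)] -/
theorem zuJ_zero (β : ℝ) : zuJ N β 0 = zu N β := by
  refine lintegral_congr fun U => ?_
  rw [srcWeight, zero_mul, Real.exp_zero, ENNReal.ofReal_one, one_mul]

/-- `z_u ≤ |z_u(J)|` (the source factor is `≥ 1`). [cite: FariaDaVeigaOCarroll2022YMStability, §6.5 (chunk p0019)] -/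
theorem zu_le_zuJ (β : ℝ) {s : ℝ} (hs : 0 ≤ s) : zu N β ≤ zuJ N β s :=
  lintegral_mono fun U => by
    calc pw N β U = 1 * pw N β U := (one_mul _).symm
      _ ≤ ENNReal.ofReal (srcWeight N β s U) * pw N β U := by
          gcongr; rw [← ENNReal.ofReal_one]; exact ENNReal.ofReal_le_ofReal (one_le_srcWeight β hs U)

/-- `|z_u(J)| < ∞` for `β ≥ 0` (bounded source weight, `w_β ≤ 1`, probability measure).
[cite: FariaDaVeigaOCarroll2022YMStability, Theorem 4 (Gb2) (chunk p0016)] -/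
theorem zuJ_lt_top {β : ℝ} (hβ : 0 ≤ β) (s : ℝ) : zuJ N β s < ∞ := by
  obtain ⟨K, hK⟩ := exists_srcWeight_le (N := N) β s
  calc zuJ N β s ≤ ∫⁻ _U, ENNReal.ofReal K * 1 ∂haarProbability (𝔾 N) :=
        lintegral_mono fun U => mul_le_mul' (ENNReal.ofReal_le_ofReal ((le_abs_self _).trans (hK U))) (pw_le_one hβ U)
    _ < ∞ := by rw [lintegral_const, measure_univ, mul_one, mul_one]; exact ENNReal.ofReal_lt_top

/-- `z_ℓ > 0` for `β ≥ 0`: the weight is `≥ exp[−16(d−1)βN]` since `‖1 − U‖² ≤ 4N` on `U(N)`.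
[cite: FariaDaVeigaOCarroll2022YMStability, Theorem 1 (zl) (chunk p0014)] -/
theorem zl_pos {β : ℝ} (hβ : 0 ≤ β) : 0 < zl d N β := by
  have hc : 0 ≤ 4 * ((d - 1 : ℕ) : ℝ) * β := by positivity
  calc (0 : ℝ≥0∞) < ENNReal.ofReal (Real.exp (-(4 * ((d - 1 : ℕ) : ℝ) * β) * (4 * (N : ℝ)))) :=
        ENNReal.ofReal_pos.2 (Real.exp_pos _)
    _ = ∫⁻ _U, ENNReal.ofReal (Real.exp (-(4 * ((d - 1 : ℕ) : ℝ) * β) * (4 * (N : ℝ)))) ∂haarProbability (𝔾 N) := by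
        rw [lintegral_const, measure_univ, mul_one]
    _ ≤ zl d N β := lintegral_mono fun U => ENNReal.ofReal_le_ofReal (Real.exp_le_exp.2 (by
        rw [neg_mul, neg_mul, neg_le_neg_iff]
        exact mul_le_mul_of_nonneg_left (norm_one_sub_sq_le U) hc))

/-! ## §2. The successive bond integrations of §6.2 for a general single-plaquette weight -/

section Cube

variable {n : ℕ}

/-- Updating one box coordinate does not change the extended configuration off that edge. [folklore] -/
private theorem ext_update_of_ne' (u : BoxCfg d (𝔾 N) n) (e₀ : ↥(boxEdges d n)) (g : 𝔾 N) {e : ZdEdge d}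
    (h : e ≠ e₀.1) : ext (update u e₀ g) e = ext u e := by
  by_cases he : e ∈ boxEdges d n
  · rw [ext_apply_of_mem _ he, ext_apply_of_mem _ he, update_of_ne]
    exact fun h' => h (congrArg Subtype.val h')
  · rw [ext_apply_of_not_mem _ he, ext_apply_of_not_mem _ he]

/-- … and on that edge it reads the new value. [folklore] -/
private theorem ext_update_self' (u : BoxCfg d (𝔾 N) n) (e₀ : ↥(boxEdges d n)) (g : 𝔾 N) {e : ZdEdge d}
    (h : e = e₀.1) : ext (update u e₀ g) e = g := by
  subst h; rw [ext_apply_of_mem _ e₀.2]; simp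

/-- A plaquette holonomy only reads its four edges. [folklore] -/
private theorem plaquette_congr_of_edges' {G : Type*} [Group G] {U V : ZdGaugeConfig d G} {p : Plaq d}
    (h : ∀ e ∈ edges p, U e = V e) : U.plaquette p.1 p.2.1 p.2.2 = V.plaquette p.1 p.2.1 p.2.2 :=
  plaquette_congr (h _ (by simp [edges])) (h _ (by simp [edges])) (h _ (by simp [edges])) (h _ (by simp [edges]))

/-- `k < topDir (y, k)` for a free edge. [folklore] -/
private theorem lt_topDir' {e : ZdEdge d} (he : ¬ IsComb e) : e.2 < topDir e := by
  have h := upDirs_nonempty_iff.2 he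
  rw [topDir, dif_pos h]
  exact ((Finset.mem_filter.1 (Finset.max'_mem _ h)).2).1

/-- The weight `w(U_{partner e})` of the partner plaquette of the edge `e` for a general single-plaquette weight `w` (source
times Boltzmann factor in §6.5), as a function of the cube configuration. [cite: FariaDaVeigaOCarroll2022YMStability, §6.5 («We bound the integral as we did for the upper stability bound», chunk p0019)] -/
def partnerWt (w : 𝔾 N → ℝ≥0∞) (e : ZdEdge d) (u : BoxCfg d (𝔾 N) n) : ℝ≥0∞ :=
  w ((ext u).plaquette (partner e).1 (partner e).2.1 (partner e).2.2)

/-- Plaquette holonomies of the extended box configuration are measurable in the box variables. [folklore] -/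
private theorem measurable_plaquette_ext' (p : Plaq d) :
    Measurable fun u : BoxCfg d (𝔾 N) n => (ext u).plaquette p.1 p.2.1 p.2.2 := by
  have h : ∀ e : ZdEdge d, Measurable fun u : BoxCfg d (𝔾 N) n => ext u e := fun e =>
    (measurable_pi_apply e).comp measurable_ext
  unfold ZdGaugeConfig.plaquette
  exact (((h _).mul (h _)).mul (h _).inv).mul (h _).inv

/-- Partner weights are measurable. [folklore] -/
private theorem measurable_partnerWt {w : 𝔾 N → ℝ≥0∞} (hw : Measurable w) (e : ZdEdge d) :
    Measurable (partnerWt (n := n) w e) :=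
  hw.comp (measurable_plaquette_ext' _)

/-- A partner weight does not see the update of a variable off its four edges. [folklore] -/
private theorem partnerWt_update_of_not_mem (w : 𝔾 N → ℝ≥0∞) {e : ZdEdge d} {e₀ : ↥(boxEdges d n)}
    (h : e₀.1 ∉ edges (partner e)) (u : BoxCfg d (𝔾 N) n) (g : 𝔾 N) :
    partnerWt w e (update u e₀ g) = partnerWt w e u := by
  unfold partnerWt
  rw [plaquette_congr_of_edges' (U := ext (update u e₀ g)) (V := ext u)
    (fun e' he' => ext_update_of_ne' u e₀ g (fun hh => h (hh ▸ he')))]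

/-- **The Haar extraction for a general weight**: integrating the variable of a free edge in the weight of its own partner
plaquette, all other variables frozen, gives `∫ w dσ` — the letter is `U(e)⁻¹` between two frozen words and the Haar probability
measure of `U(N)` is left-, right- and inversion-invariant («using the left or right invariance of the Haar measure, the integral
is independent of the other variables», §6.2, applied in §6.5 to the weight with source). [cite: FariaDaVeigaOCarroll2022YMStability, §6.2 (chunk p0018), §6.5 (p0019)] -/
theorem lintegral_partnerWt_update (w : 𝔾 N → ℝ≥0∞) {e₀ : ↥(boxEdges d n)} (he₀ : ¬ IsComb e₀.1)
    (u : BoxCfg d (𝔾 N) n) :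
    ∫⁻ g, partnerWt w e₀.1 (update u e₀ g) ∂haarProbability (𝔾 N) = ∫⁻ g, w g ∂haarProbability (𝔾 N) := by
  obtain ⟨⟨y, k⟩, hy⟩ := e₀
  have hm : k < topDir (y, k) := lt_topDir' he₀
  have hne2 : topDir (y, k) ≠ k := ne_of_gt hm
  have hE1 : (y - Pi.single (topDir (y, k)) 1, k) ≠ (y, k) := by
    intro h
    have h2 : (Pi.single (topDir (y, k)) (1 : ℤ) : ZSite d) = 0 := sub_eq_self.1 (Prod.mk.inj h).1
    have h3 := congrFun h2 (topDir (y, k))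
    simp at h3
  have hE2 : (y - Pi.single (topDir (y, k)) 1 + Pi.single k 1, topDir (y, k)) ≠ (y, k) :=
    fun h => hne2 (Prod.mk.inj h).2
  have hE3 : (y - Pi.single (topDir (y, k)) 1 + Pi.single (topDir (y, k)) 1, k) = (y, k) := by
    rw [sub_add_cancel]
  have hE4 : (y - Pi.single (topDir (y, k)) 1, topDir (y, k)) ≠ (y, k) := fun h => hne2 (Prod.mk.inj h).2
  set a : 𝔾 N := ext u (y - Pi.single (topDir (y, k)) 1, k) *
    ext u (y - Pi.single (topDir (y, k)) 1 + Pi.single k 1, topDir (y, k)) with ha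
  set c : 𝔾 N := ext u (y - Pi.single (topDir (y, k)) 1, topDir (y, k)) with hc
  have hhol : ∀ g : 𝔾 N, partnerWt w (y, k) (update u ⟨(y, k), hy⟩ g) = w (a * g⁻¹ * c⁻¹) := by
    intro g
    simp only [partnerWt, partner, ZdGaugeConfig.plaquette]
    rw [ext_update_of_ne' u ⟨(y, k), hy⟩ g hE1, ext_update_of_ne' u ⟨(y, k), hy⟩ g hE2, hE3,
      ext_update_self' u ⟨(y, k), hy⟩ g rfl, ext_update_of_ne' u ⟨(y, k), hy⟩ g hE4]
  show ∫⁻ g, partnerWt w (y, k) (update u ⟨(y, k), hy⟩ g) ∂haarProbability (𝔾 N) = _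
  simp_rw [hhol]
  have h1 := lintegral_inv_eq_self (μ := haarProbability (𝔾 N)) (fun g : 𝔾 N => w (a * g * c⁻¹))
  rw [h1]
  have h2 := lintegral_mul_left_eq_self (μ := haarProbability (𝔾 N)) (fun g : 𝔾 N => w (g * c⁻¹)) a
  rw [h2]
  have h3 := lintegral_mul_right_eq_self (μ := haarProbability (𝔾 N)) (fun g : 𝔾 N => w g) c⁻¹
  rw [h3]

/-- The product of the partner weights over a family `T` of (free) box edges, general weight. [cite: FariaDaVeigaOCarroll2022YMStability, §6.2 (chunk p0018), §6.5 (p0019)] -/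
def prodPartnerWt (w : 𝔾 N → ℝ≥0∞) (T : Finset ↥(boxEdges d n)) (u : BoxCfg d (𝔾 N) n) : ℝ≥0∞ :=
  ∏ e ∈ T, partnerWt w e.1 u

/-- Products of partner weights are measurable. [folklore] -/
private theorem measurable_prodPartnerWt {w : 𝔾 N → ℝ≥0∞} (hw : Measurable w) (T : Finset ↥(boxEdges d n)) :
    Measurable (prodPartnerWt w T) :=
  Finset.measurable_prod _ fun e _ => measurable_partnerWt hw e.1

/-- **The exact product formula, general weight**: for every family `T` of free edges of the cube and every measurable
single-plaquette weight `w`, `∫ ∏_{e ∈ T} w(U_{partner e}) dσ^{E_n}(U) = (∫ w dσ)^{#T}` — induction on the free edge of maximal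
`ℓ¹` height (`l1_eq_of_mem_edges_partner`), Tonelli one variable at a time and the Haar extraction; with `w = exp[|J|γ^{1/2}
|tr(U−1)|] w_β` this is the §6.5 step «We bound the integral as we did for the upper stability bound for the free b.c. case. In
this manner, we obtain the factorized bound `|Z^P_{Λ,a}(J)| ≤ [z_u(J)]^{Λ_r}`». [cite: FariaDaVeigaOCarroll2022YMStability, §6.5 (chunk p0019); §6.2 (p0018)] -/
theorem lintegral_prodPartnerWt_eq {w : 𝔾 N → ℝ≥0∞} (hw : Measurable w) (T : Finset ↥(boxEdges d n))
    (hT : ∀ e ∈ T, ¬ IsComb e.1) :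
    ∫⁻ u, prodPartnerWt w T u ∂Measure.pi (fun _ : ↥(boxEdges d n) => haarProbability (𝔾 N)) =
      (∫⁻ g, w g ∂haarProbability (𝔾 N)) ^ #T := by
  classical
  revert hT
  refine Finset.induction_on_max_value (f := fun e : ↥(boxEdges d n) => l1 e.1.1)
    (motive := fun T => (∀ e ∈ T, ¬ IsComb e.1) →
      ∫⁻ u, prodPartnerWt w T u ∂Measure.pi (fun _ : ↥(boxEdges d n) => haarProbability (𝔾 N)) =
        (∫⁻ g, w g ∂haarProbability (𝔾 N)) ^ #T)
    T ?_ ?_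
  · intro _
    simp [prodPartnerWt]
  · intro a s has hmax ih hfree
    have ha : ¬ IsComb a.1 := hfree a (Finset.mem_insert_self _ _)
    have hs : ∀ e ∈ s, ¬ IsComb e.1 := fun e he => hfree e (Finset.mem_insert_of_mem he)
    have haF : a.1 ∈ freeEdges d n := Finset.mem_filter.2 ⟨a.2, ha⟩
    -- the maximal edge `a` is private to its own partner plaquette
    have hpriv : ∀ e ∈ s, a.1 ∉ edges (partner e.1) := by
      intro e he hmem
      have heF : e.1 ∈ freeEdges d n := Finset.mem_filter.2 ⟨e.2, hs e he⟩
      have hne : a.1 ≠ e.1 := fun h => has (Subtype.ext h ▸ he)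
      have h1 := l1_eq_of_mem_edges_partner heF haF hmem hne
      have h2 : l1 e.1.1 ≤ l1 a.1.1 := hmax e he
      omega
    have hupd : ∀ (u : BoxCfg d (𝔾 N) n) (g : 𝔾 N), prodPartnerWt w s (update u a g) = prodPartnerWt w s u :=
      fun u g => Finset.prod_congr rfl fun e he => partnerWt_update_of_not_mem w (hpriv e he) u g
    set μs : ↥(boxEdges d n) → Measure (𝔾 N) := fun _ => haarProbability (𝔾 N) with hμs
    set Φ : BoxCfg d (𝔾 N) n → ℝ≥0∞ := fun u => partnerWt w a.1 u * prodPartnerWt w s u with hΦ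
    set Ψ : BoxCfg d (𝔾 N) n → ℝ≥0∞ := fun u => (∫⁻ g, w g ∂haarProbability (𝔾 N)) * prodPartnerWt w s u with hΨ
    have hΦm : Measurable Φ := (measurable_partnerWt hw a.1).mul (measurable_prodPartnerWt hw s)
    have hΨm : Measurable Ψ := (measurable_prodPartnerWt hw s).const_mul _
    have hins : prodPartnerWt w (insert a s) = Φ := by
      funext u; simp only [prodPartnerWt, hΦ, Finset.prod_insert has]
    have hmarg : (∫⋯∫⁻_{a}, Φ ∂μs) = (∫⋯∫⁻_{a}, Ψ ∂μs) := by
      rw [lmarginal_singleton, lmarginal_singleton]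
      funext u
      simp only [hΦ, hΨ, hμs, hupd]
      have hmeas : Measurable fun g : 𝔾 N => partnerWt w a.1 (update u a g) :=
        (measurable_partnerWt hw a.1).comp (measurable_update u)
      rw [lintegral_mul_const _ hmeas, lintegral_partnerWt_update w ha u, lintegral_const, measure_univ, mul_one]
    have hint : ∫⁻ u, Φ u ∂Measure.pi μs = ∫⁻ u, Ψ u ∂Measure.pi μs := by
      rw [lintegral_eq_lmarginal_univ (1 : BoxCfg d (𝔾 N) n), lintegral_eq_lmarginal_univ (1 : BoxCfg d (𝔾 N) n),
        ← Finset.sdiff_union_of_subset (Finset.subset_univ {a}),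
        lmarginal_union _ _ hΦm Finset.sdiff_disjoint, lmarginal_union _ _ hΨm Finset.sdiff_disjoint, hmarg]
    rw [hins, hint, hΨ, lintegral_const_mul _ (measurable_prodPartnerWt hw s), ih hs, Finset.card_insert_of_notMem has,
      pow_succ']

/-- `Torus.proj L` is injective on the cube `B_L = {0,…,L−1}^d`. [folklore] -/
private theorem torusProj_injOn_halfOpenBox' (L : ℕ) :
    Set.InjOn (Torus.proj (d := d) L) (halfOpenBox d L : Set (ZSite d)) := by
  intro x hx y hy hxy
  funext k
  have hk : ((x k : ℤ) : ZMod L) = ((y k : ℤ) : ZMod L) := congrFun hxy k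
  rw [ZMod.intCast_eq_intCast_iff_dvd_sub] at hk
  obtain ⟨hx1, hx2⟩ := mem_halfOpenBox.1 (Finset.mem_coe.1 hx) k
  obtain ⟨hy1, hy2⟩ := mem_halfOpenBox.1 (Finset.mem_coe.1 hy) k
  have hlt : |y k - x k| < (L : ℤ) := by rw [abs_lt]; constructor <;> linarith
  have h0 := Int.eq_zero_of_abs_lt_dvd hk hlt
  linarith

/-- `ext (V|_{B_n})` has the plaquette holonomies of `V` on the plaquettes of `B_n`. [folklore] -/
private theorem plaquette_ext_restrict {G : Type*} [Group G] (V : ZdGaugeConfig d G) {p : Plaq d}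
    (hp : p ∈ plaquettesIn (halfOpenBox d n)) :
    (ext ((boxEdges d n).restrict V)).plaquette p.1 p.2.1 p.2.2 = V.plaquette p.1 p.2.1 p.2.2 := by
  obtain ⟨h1, h2, h3, h4⟩ := edges_mem_boxEdges hp
  exact plaquette_congr (ext_restrict_apply V h1) (ext_restrict_apply V h2) (ext_restrict_apply V h3)
    (ext_restrict_apply V h4)

end Cube

/-! ## §3. The array of the multi-reflection method on even corners and its free bonds -/

section Array

variable {M : ℕ} [NeZero M] [NeZero d]

variable (d) in
/-- The top coordinate direction `d − 1` (the second direction of the plane `0,(d−1)` carrying the array; any plane through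
the `0` axis is equivalent by the lattice symmetry, `integral_plaquette_eq_of_symmetry`). [folklore] -/
def dTop : Fin d := ⟨d - 1, Nat.sub_lt (Nat.pos_of_neZero d) one_pos⟩

omit [NeZero M] in
/-- Every direction is `≤ d − 1`. [folklore] -/
private theorem le_dTop (m : Fin d) : m ≤ dTop d := by
  change m.val ≤ d - 1
  have := m.isLt
  omega

omit [NeZero M] in
/-- `d − 1 ≠ 0` when `d ≥ 2`. [folklore] -/
private theorem dTop_ne_zero (hd : 2 ≤ d) : dTop d ≠ 0 := by
  intro h
  have h1 : (dTop d).val = (0 : Fin d).val := by rw [h]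
  change d - 1 = (0 : Fin d).val at h1
  rw [Fin.val_zero] at h1
  omega

/-- The EVEN corner `(2c_j)_j ∈ ℤ^d` of the array plaquette of the block `c` (the array of `FdVOC22MultiReflectionBound` translated
by `−(1,…,1)`, so that every array plaquette is an interior plaquette of the cube `B_L`). [cite: FariaDaVeigaOCarroll2022YMStability, §6.5 (the array, chunk p0019)] -/
def evenCorner (c : BlockIdx d M) : ZSite d := fun j => ((2 * (c j).val : ℕ) : ℤ)

/-- The even corner on the torus `(ℤ/2Mℤ)^d`: `(2c_j)_j`. [cite: FariaDaVeigaOCarroll2022YMStability, §6.5 (the array, chunk p0019)] -/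
def evenSite (c : BlockIdx d M) : Site d (2 * M) := fun j => dbl (c j)

omit [NeZero d] in
/-- The even corner projects to the even site. [folklore] -/
private theorem proj_evenCorner (c : BlockIdx d M) : Torus.proj (2 * M) (evenCorner c) = evenSite c := by
  funext j
  simp only [Torus.proj_apply, evenCorner, evenSite, dbl_eq, Int.cast_natCast]

omit [NeZero M] [NeZero d] in
/-- The odd-corner array of `FdVOC22MultiReflectionBound` translated by `−(1,…,1)` is the even-corner array. [folklore] -/
private theorem blockSite_sub_one (c : BlockIdx d M) : blockSite c - (fun _ => 1) = evenSite c := by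
  funext j
  simp only [blockSite, evenSite, Pi.sub_apply, add_sub_cancel_right]

/-- The free bond `((2c) + e_{d−1}, 0)` whose partner plaquette is the array plaquette of the block `c`.
[cite: FariaDaVeigaOCarroll2022YMStability, §6.5 («We bound the integral as we did for the upper stability bound», chunk p0019)] -/
def arrayEdge (c : BlockIdx d M) : ZdEdge d := (evenCorner c + Pi.single (dTop d) 1, 0)

omit [NeZero d] in
/-- Coordinates of the even corner. [folklore] -/
private theorem evenCorner_bounds (c : BlockIdx d M) (j : Fin d) :
    0 ≤ evenCorner c j ∧ evenCorner c j + 2 ≤ 2 * (M : ℤ) := by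
  have := ZMod.val_lt (c j)
  simp only [evenCorner]
  omega

/-- The array bond is a bond of the cube `B_{2M}` (`d ≥ 2`). [cite: FariaDaVeigaOCarroll2022YMStability, §6.5 (chunk p0019)] -/
theorem arrayEdge_mem_boxEdges (hd : 2 ≤ d) (c : BlockIdx d M) : arrayEdge c ∈ boxEdges d (2 * M) := by
  have h0 : (0 : Fin d) ≠ dTop d := (dTop_ne_zero hd).symm
  rw [arrayEdge, mem_boxEdges_iff]
  refine ⟨fun k => ?_, ?_⟩
  · obtain ⟨h1, h2⟩ := evenCorner_bounds c k
    by_cases hk : k = dTop d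
    · subst hk; simp only [Pi.add_apply, Pi.single_eq_same]; push_cast; omega
    · simp only [Pi.add_apply, Pi.single_eq_of_ne hk, add_zero]; push_cast; omega
  · obtain ⟨h1, h2⟩ := evenCorner_bounds c 0
    simp only [Pi.add_apply, Pi.single_eq_of_ne h0, add_zero]; push_cast; omega

omit [NeZero M] in
/-- The array bond is not on the comb tree: its `(d−1)`-th coordinate `2c_{d−1} + 1` is odd. [cite: FariaDaVeigaOCarroll2022YMStability, §6.5 (chunk p0019)] -/
theorem not_isComb_arrayEdge (hd : 2 ≤ d) (c : BlockIdx d M) : ¬ IsComb (arrayEdge c) := by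
  intro h
  have h1 := h (dTop d) (Fin.pos_iff_ne_zero.2 (dTop_ne_zero hd))
  simp only [arrayEdge, Pi.add_apply, Pi.single_eq_same, evenCorner] at h1
  omega

omit [NeZero M] in
/-- The top direction of the array bond is `d − 1`. [folklore] -/
private theorem topDir_arrayEdge (hd : 2 ≤ d) (c : BlockIdx d M) : topDir (arrayEdge c) = dTop d := by
  have hmem : dTop d ∈ upDirs (arrayEdge c) := by
    refine Finset.mem_filter.2 ⟨Finset.mem_univ _, Fin.pos_iff_ne_zero.2 (dTop_ne_zero hd), ?_⟩
    simp only [arrayEdge, Pi.add_apply, Pi.single_eq_same, evenCorner]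
    omega
  have hne : (upDirs (arrayEdge c)).Nonempty := ⟨_, hmem⟩
  rw [topDir, dif_pos hne]
  exact le_antisymm (Finset.max'_le _ hne _ fun m _ => le_dTop m) (Finset.le_max' _ _ hmem)

omit [NeZero M] in
/-- **The array plaquettes are partner plaquettes**: `partner((2c) + e_{d−1}, 0) = ((2c); 0, d−1)`.
[cite: FariaDaVeigaOCarroll2022YMStability, §6.5 (chunk p0019); §6.2 (p0018)] -/
theorem partner_arrayEdge (hd : 2 ≤ d) (c : BlockIdx d M) :
    partner (arrayEdge c) = (evenCorner c, (0 : Fin d), dTop d) := by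
  rw [partner, topDir_arrayEdge hd c]
  simp only [arrayEdge, add_sub_cancel_right]

omit [NeZero d] in
/-- Distinct blocks have distinct even corners. [folklore] -/
private theorem evenCorner_injective : Injective (evenCorner (d := d) (M := M)) := by
  intro c c' h
  funext j
  have hj := congrFun h j
  simp only [evenCorner, Nat.cast_inj] at hj
  exact (ZMod.val_injective M) (by omega)

/-- Distinct blocks have distinct array bonds. [cite: FariaDaVeigaOCarroll2022YMStability, §6.5 (chunk p0019)] -/
theorem arrayEdge_injective : Injective (arrayEdge (d := d) (M := M)) := fun _ _ h =>
  evenCorner_injective (add_right_cancel (Prod.mk.inj h).1)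

/-- The array plaquettes are interior plaquettes of the cube `B_{2M}`. [cite: FariaDaVeigaOCarroll2022YMStability, §6.5 (chunk p0019)] -/
theorem arrayPlaq_mem_plaquettesIn (hd : 2 ≤ d) (c : BlockIdx d M) :
    ((evenCorner c, (0 : Fin d), dTop d) : Plaq d) ∈ plaquettesIn (halfOpenBox d (2 * M)) := by
  rw [← partner_arrayEdge hd c]
  exact partner_mem_plaquettesIn (Finset.mem_filter.2 ⟨arrayEdge_mem_boxEdges hd c, not_isComb_arrayEdge hd c⟩)

end Array

/-! ## §4. «`|Z_{Λ,a}(J)| ≤ [z_u(J)]^{Λ_r}`»: the cube with sources on the array -/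

section CubeSource

variable {M : ℕ} [NeZero M] [NeZero d]

/-- **The cube bound with sources** (§6.5: «we discard plaquette actions … We bound the integral as we did for the upper
stability bound for the free b.c. case … `|Z^P_{Λ,a}(J)| ≤ [z_u(J)]^{Λ_r}`»): for the cube `B_{2M}` with free b.c., the
Boltzmann weight times the source factors `exp[s γ^{1/2}|tr(U_p − 1)|]` on the array plaquettes integrates to at most
`|z_u(J)|^{Λ_r}`, `Λ_r = #E^1_{2M}`, `s = |J| ≥ 0`, `β ≥ 0` — drop the non-partner plaquette weights (`≤ 1`), insert source factors
(`≥ 1`) on the remaining partner plaquettes, and integrate the free bonds top-down (`lintegral_prodPartnerWt_eq`).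
[cite: FariaDaVeigaOCarroll2022YMStability, §6.5 (chunk p0019)] -/
theorem lintegral_cube_src_le (hd : 2 ≤ d) {β : ℝ} (hβ : 0 ≤ β) {s : ℝ} (hs : 0 ≤ s) :
    ∫⁻ u, (∏ c : BlockIdx d M, ENNReal.ofReal (srcWeight N β s ((ext u).plaquette (evenCorner c) 0 (dTop d)))) *
        ENNReal.ofReal (Real.exp (-β * S d N (2 * M) (ext u)))
        ∂Measure.pi (fun _ : ↥(boxEdges d (2 * M)) => haarProbability (𝔾 N)) ≤
      zuJ N β s ^ #(freeEdges d (2 * M)) := by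
  classical
  set T : Finset ↥(boxEdges d (2 * M)) := univ.filter fun e => ¬ IsComb e.1 with hT
  have hTfree : ∀ e ∈ T, ¬ IsComb e.1 := fun e he => (Finset.mem_filter.1 he).2
  have hcard : #T = #(freeEdges d (2 * M)) := by
    rw [hT, ← Fintype.card_subtype, card_freeIdx]
  set w : 𝔾 N → ℝ≥0∞ := fun g => ENNReal.ofReal (srcWeight N β s g) * pw N β g with hw_def
  have hw : Measurable w :=
    (ENNReal.measurable_ofReal.comp (continuous_srcWeight β s).measurable).mul (measurable_pw' β)
  have hzuJ : ∫⁻ g, w g ∂haarProbability (𝔾 N) = zuJ N β s := rfl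
  rw [← hcard, ← hzuJ, ← lintegral_prodPartnerWt_eq hw T hTfree]
  refine lintegral_mono fun u => ?_
  -- the injection block ↦ array bond
  set ε : BlockIdx d M → ↥(boxEdges d (2 * M)) := fun c => ⟨arrayEdge c, arrayEdge_mem_boxEdges hd c⟩ with hε
  have hεinj : Injective ε := fun c c' h => arrayEdge_injective (congrArg Subtype.val h)
  have hεT : univ.image ε ⊆ T := by
    intro e he
    obtain ⟨c, -, rfl⟩ := Finset.mem_image.1 he
    exact Finset.mem_filter.2 ⟨Finset.mem_univ _, not_isComb_arrayEdge hd c⟩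
  set P := plaquettesIn (halfOpenBox d (2 * M)) with hP
  set P' := T.image fun e => partner e.1 with hP'
  have hsub : P' ⊆ P := Finset.image_subset_iff.2 fun e he =>
    partner_mem_plaquettesIn (Finset.mem_filter.2 ⟨e.2, hTfree e he⟩)
  have hinj : ∀ e ∈ T, ∀ e' ∈ T, partner e.1 = partner e'.1 → e = e' :=
    fun e _ e' _ h => Subtype.ext (partner_injective h)
  -- the source factors sit on partner plaquettes of array bonds
  have h1 : ∏ c : BlockIdx d M, ENNReal.ofReal (srcWeight N β s ((ext u).plaquette (evenCorner c) 0 (dTop d))) ≤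
      ∏ e ∈ T, ENNReal.ofReal (srcWeight N β s
        ((ext u).plaquette (partner e.1).1 (partner e.1).2.1 (partner e.1).2.2)) := by
    have hre : ∀ c : BlockIdx d M, ENNReal.ofReal (srcWeight N β s ((ext u).plaquette (evenCorner c) 0 (dTop d))) =
        ENNReal.ofReal (srcWeight N β s
          ((ext u).plaquette (partner (ε c).1).1 (partner (ε c).1).2.1 (partner (ε c).1).2.2)) := fun c => by
      rw [hε]; simp only [partner_arrayEdge hd c]
    calc ∏ c : BlockIdx d M, ENNReal.ofReal (srcWeight N β s ((ext u).plaquette (evenCorner c) 0 (dTop d)))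
        = ∏ c : BlockIdx d M, ENNReal.ofReal (srcWeight N β s
            ((ext u).plaquette (partner (ε c).1).1 (partner (ε c).1).2.1 (partner (ε c).1).2.2)) :=
          Finset.prod_congr rfl fun c _ => hre c
      _ = ∏ e ∈ univ.image ε, ENNReal.ofReal (srcWeight N β s
            ((ext u).plaquette (partner e.1).1 (partner e.1).2.1 (partner e.1).2.2)) :=
          (Finset.prod_image (s := univ) (g := ε) (f := fun e : ↥(boxEdges d (2 * M)) => ENNReal.ofReal (srcWeight N β s
            ((ext u).plaquette (partner e.1).1 (partner e.1).2.1 (partner e.1).2.2))) fun c _ c' _ h => hεinj h).symm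
      _ ≤ _ := Finset.prod_le_prod_of_subset_of_one_le' hεT fun e _ _ => by
          rw [← ENNReal.ofReal_one]; exact ENNReal.ofReal_le_ofReal (one_le_srcWeight β hs _)
  -- drop the non-partner plaquette weights
  have h2 : ∏ p ∈ P, pw N β ((ext u).plaquette p.1 p.2.1 p.2.2) ≤ ∏ p ∈ P', pw N β ((ext u).plaquette p.1 p.2.1 p.2.2) := by
    calc ∏ p ∈ P, pw N β ((ext u).plaquette p.1 p.2.1 p.2.2)
        = (∏ p ∈ P \ P', pw N β ((ext u).plaquette p.1 p.2.1 p.2.2)) *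
            ∏ p ∈ P', pw N β ((ext u).plaquette p.1 p.2.1 p.2.2) := (Finset.prod_sdiff hsub).symm
      _ ≤ 1 * ∏ p ∈ P', pw N β ((ext u).plaquette p.1 p.2.1 p.2.2) := by
          gcongr
          exact Finset.prod_le_one' fun p _ => pw_le_one hβ _
      _ = _ := one_mul _
  rw [weight_eq_prod]
  calc (∏ c : BlockIdx d M, ENNReal.ofReal (srcWeight N β s ((ext u).plaquette (evenCorner c) 0 (dTop d)))) *
        ∏ p ∈ P, pw N β ((ext u).plaquette p.1 p.2.1 p.2.2)
      ≤ (∏ e ∈ T, ENNReal.ofReal (srcWeight N β s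
          ((ext u).plaquette (partner e.1).1 (partner e.1).2.1 (partner e.1).2.2))) *
          ∏ p ∈ P', pw N β ((ext u).plaquette p.1 p.2.1 p.2.2) := mul_le_mul' h1 h2
    _ = prodPartnerWt w T u := by
        rw [hP', Finset.prod_image hinj, prodPartnerWt, ← Finset.prod_mul_distrib]
        rfl

end CubeSource

/-! ## §5. The torus expectation of the array source: `≤ |z_u(J)|^{Λ_r} / z_ℓ^{Λ_r+Λ_e}` -/

section TorusSource

variable {M : ℕ} [NeZero M] [NeZero d]

omit [NeZero M] [NeZero d] in
/-- The torus weight is measurable. [folklore] -/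
private theorem measurable_torusWeight' {L : ℕ} [NeZero L] (β : ℝ) :
    Measurable fun U : GaugeConfig d L (𝔾 N) => ENNReal.ofReal (Real.exp (-β * wilsonAction ρN U)) :=
  ENNReal.measurable_ofReal.comp (Real.measurable_exp.comp
    ((continuous_wilsonAction _ (continuous_unitaryFundamentalRep (Fin N) ℂ)).measurable.const_mul _))

/-- **Torus ≤ cube with sources** («for the periodic model … we discard plaquette actions in `A^P`, for plaquettes that are not in
Λ so that `|Z^P_{Λ,a}(J)| ≤ ∫ exp[|J| … Σ''_p … − a^{d−4}A/g²] dg`», then §4): the un-normalized torus integral of the array source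
factors is at most `|z_u(J)|^{Λ_r}`. [cite: FariaDaVeigaOCarroll2022YMStability, §6.5 (chunk p0019)] -/
theorem lintegral_torus_src_le (hd : 2 ≤ d) {β : ℝ} (hβ : 0 ≤ β) {s : ℝ} (hs : 0 ≤ s) :
    ∫⁻ U, (∏ c : BlockIdx d M, ENNReal.ofReal (srcWeight N β s (plaquetteHolonomy U (evenSite c) 0 (dTop d)))) *
        ENNReal.ofReal (Real.exp (-β * wilsonAction ρN U))
        ∂Measure.pi (fun _ : Edge d (2 * M) => haarProbability (𝔾 N)) ≤
      zuJ N β s ^ #(freeEdges d (2 * M)) := by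
  classical
  set τ : ↥(boxEdges d (2 * M)) → Edge d (2 * M) := fun e => torusEdge (2 * M) e.1 with hτ
  have hτinj : Function.Injective τ := by
    intro e e' h
    simp only [hτ, torusEdge, Prod.mk.injEq] at h
    have h1 := (mem_boxEdges.1 e.2).1
    have h1' := (mem_boxEdges.1 e'.2).1
    exact Subtype.ext (Prod.ext (torusProj_injOn_halfOpenBox' (2 * M) (Finset.mem_coe.2 h1) (Finset.mem_coe.2 h1') h.1)
      h.2)
  have hmeasτ : Measurable fun (U : GaugeConfig d (2 * M) (𝔾 N)) (e : ↥(boxEdges d (2 * M))) => U (τ e) :=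
    measurable_pi_lambda _ fun e => measurable_pi_apply _
  set Φ : BoxCfg d (𝔾 N) (2 * M) → ℝ≥0∞ := fun u =>
    (∏ c : BlockIdx d M, ENNReal.ofReal (srcWeight N β s ((ext u).plaquette (evenCorner c) 0 (dTop d)))) *
      ENNReal.ofReal (Real.exp (-β * S d N (2 * M) (ext u))) with hΦ
  have hΦm : Measurable Φ :=
    (Finset.measurable_prod _ fun c _ => ENNReal.measurable_ofReal.comp
      ((continuous_srcWeight β s).measurable.comp
        (measurable_plaquette_ext' (N := N) (n := 2 * M) ((evenCorner c, (0 : Fin d), dTop d) : Plaq d)))).mul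
      (ENNReal.measurable_ofReal.comp (Real.measurable_exp.comp ((measurable_S_ext (2 * M)).const_mul _)))
  calc ∫⁻ U, (∏ c : BlockIdx d M, ENNReal.ofReal (srcWeight N β s (plaquetteHolonomy U (evenSite c) 0 (dTop d)))) *
        ENNReal.ofReal (Real.exp (-β * wilsonAction ρN U)) ∂Measure.pi (fun _ : Edge d (2 * M) => haarProbability (𝔾 N))
      ≤ ∫⁻ U, Φ (fun e => U (τ e)) ∂Measure.pi (fun _ : Edge d (2 * M) => haarProbability (𝔾 N)) := by
        refine lintegral_mono fun U => ?_
        have hres : (fun e : ↥(boxEdges d (2 * M)) => U (τ e)) = (boxEdges d (2 * M)).restrict (torusLift (2 * M) U) := rfl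
        have hplaq : ∀ c : BlockIdx d M,
            (ext ((boxEdges d (2 * M)).restrict (torusLift (2 * M) U))).plaquette (evenCorner c) 0 (dTop d) =
              plaquetteHolonomy U (evenSite c) 0 (dTop d) := fun c => by
          rw [plaquette_ext_restrict (n := 2 * M) (torusLift (2 * M) U) (arrayPlaq_mem_plaquettesIn hd c),
            plaquette_torusLift, proj_evenCorner]
        simp only [hΦ, hres, hplaq, WilsonWeakCoupling.S, zdWilsonAction_ext_restrict]
        gcongr _ * ?_
        refine ENNReal.ofReal_le_ofReal (Real.exp_le_exp.2 ?_)
        have h := S_torusLift_le_wilsonAction (d := d) (N := N) (L := 2 * M) U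
        simp only [WilsonWeakCoupling.S] at h
        nlinarith
    _ = ∫⁻ u, Φ u ∂((Measure.pi fun _ : Edge d (2 * M) => haarProbability (𝔾 N)).map fun U e => U (τ e)) :=
        (lintegral_map hΦm hmeasτ).symm
    _ = ∫⁻ u, Φ u ∂Measure.pi (fun _ : ↥(boxEdges d (2 * M)) => haarProbability (𝔾 N)) := by
        rw [map_comp_pi_of_injective _ hτinj]
    _ ≤ zuJ N β s ^ #(freeEdges d (2 * M)) := lintegral_cube_src_le hd hβ hs

/-- Bounded measurable real functions on a probability space are integrable. [folklore] -/
private theorem integrable_of_bdd' {Ω : Type*} [MeasurableSpace Ω] {μ : Measure Ω} [IsProbabilityMeasure μ] {A : Ω → ℝ}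
    (hA : ∃ K : ℝ, ∀ ω, |A ω| ≤ K) (hAm : Measurable A) : Integrable A μ := by
  obtain ⟨K, hK⟩ := hA
  exact Integrable.of_bound hAm.aestronglyMeasurable K (ae_of_all _ fun ω => by
    rw [Real.norm_eq_abs]; exact hK ω)

omit [NeZero M] [NeZero d] in
/-- **The normalized torus expectation as a partition-function ratio**: for a bounded measurable `F ≥ 0`,
`∫ F dμ^P = (Z^P)⁻¹ ∫ F e^{−βS^P} dσ^{E}` — «`G_{Λ,a}(J) = [Z^P_{Λ,a}]^{−1} Z^P_{Λ,a}(J)`».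
[cite: FariaDaVeigaOCarroll2022YMStability, §6.5 (chunk p0019)] -/
theorem ofReal_integral_wilsonMeasure {L : ℕ} [NeZero L] (β : ℝ) {F : GaugeConfig d L (𝔾 N) → ℝ} (hFm : Measurable F)
    (hF0 : ∀ U, 0 ≤ F U) (hFb : ∃ K : ℝ, ∀ U, |F U| ≤ K) :
    ENNReal.ofReal (∫ U, F U ∂(wilsonMeasure ρN β)) =
      (ZP d N L β)⁻¹ * ∫⁻ U, ENNReal.ofReal (Real.exp (-β * wilsonAction ρN U)) * ENNReal.ofReal (F U)
        ∂Measure.pi (fun _ : Edge d L => haarProbability (𝔾 N)) := by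
  haveI := isProbabilityMeasure_wilsonMeasure (d := d) (L := L) ρN (continuous_unitaryFundamentalRep (Fin N) ℂ) β
  rw [ofReal_integral_eq_lintegral_ofReal (integrable_of_bdd' hFb hFm) (ae_of_all _ hF0)]
  rw [wilsonMeasure, lintegral_smul_measure, smul_eq_mul, wilsonWeight,
    lintegral_withDensity_eq_lintegral_mul _ (measurable_torusWeight' β) hFm.ennreal_ofReal]
  rfl

/-- **The multi-reflection numerator/denominator bound** («`|G_{Λ,a}(rJ_j)|` … `|Z^P_{Λ,a}(J)| ≤ [z_u(J)]^{Λ_r}` … Here, we have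
used the factorized lower bound of Theorems 1 and 2 for `Z^P_{Λ,a}`»): the torus Wilson expectation of the product of the source
factors over the block array is at most `|z_u(J)|^{Λ_r} / z_ℓ^{Λ_r+Λ_e}`, `Λ_r = #E^1_L`, `Λ_r + Λ_e = dL^d − (L^d − 1)`, `L = 2M`,
for `U(N)`, `d ≥ 2`, `β ≥ 0`, `s = |J| ≥ 0`. [cite: FariaDaVeigaOCarroll2022YMStability, §6.5 (chunk p0019); Theorem 1 (sbperiodic) (p0014)] -/
theorem integral_prod_srcWeight_le (hd : 2 ≤ d) {β : ℝ} (hβ : 0 ≤ β) {s : ℝ} (hs : 0 ≤ s) :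
    ∫ U, ∏ c : BlockIdx d M, srcWeight N β s (plaquetteHolonomy U (blockSite c) 0 (dTop d)) ∂(wilsonMeasure ρN β) ≤
      (zuJ N β s).toReal ^ #(freeEdges d (2 * M)) / (zl d N β).toReal ^ (d * (2 * M) ^ d - ((2 * M) ^ d - 1)) := by
  -- translate the odd-corner array to the even-corner array
  have htrans : ∫ U, ∏ c : BlockIdx d M, srcWeight N β s (plaquetteHolonomy U (blockSite c) 0 (dTop d))
      ∂(wilsonMeasure ρN β) =
      ∫ U, ∏ c : BlockIdx d M, srcWeight N β s (plaquetteHolonomy U (evenSite c) 0 (dTop d)) ∂(wilsonMeasure ρN β) := by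
    have h := integral_map_equiv
      (torusConfigShift (fun _ => (1 : ZMod (2 * M))) : GaugeConfig d (2 * M) (𝔾 N) ≃ᵐ GaugeConfig d (2 * M) (𝔾 N))
      (μ := wilsonMeasure ρN β)
      (fun U => ∏ c : BlockIdx d M, srcWeight N β s (plaquetteHolonomy U (blockSite c) 0 (dTop d)))
    rw [wilsonMeasure_map_torusConfigShift ρN β] at h
    rw [h]
    refine integral_congr_ae (ae_of_all _ fun U => ?_)
    simp only [plaquetteHolonomy_torusConfigShift, blockSite_sub_one]
  rw [htrans]
  set I := ∫ U, ∏ c : BlockIdx d M, srcWeight N β s (plaquetteHolonomy U (evenSite c) 0 (dTop d)) ∂(wilsonMeasure ρN β)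
    with hI
  have hF0 : ∀ U : GaugeConfig d (2 * M) (𝔾 N),
      0 ≤ ∏ c : BlockIdx d M, srcWeight N β s (plaquetteHolonomy U (evenSite c) 0 (dTop d)) :=
    fun U => Finset.prod_nonneg fun c _ => (srcWeight_pos β s _).le
  have hFm : Measurable fun U : GaugeConfig d (2 * M) (𝔾 N) =>
      ∏ c : BlockIdx d M, srcWeight N β s (plaquetteHolonomy U (evenSite c) 0 (dTop d)) :=
    Finset.measurable_prod _ fun c _ =>
      (continuous_srcWeight β s).measurable.comp (measurable_plaquetteHolonomy _ _ _)
  have hFb : ∃ K : ℝ, ∀ U : GaugeConfig d (2 * M) (𝔾 N),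
      |∏ c : BlockIdx d M, srcWeight N β s (plaquetteHolonomy U (evenSite c) 0 (dTop d))| ≤ K := by
    obtain ⟨K, hK⟩ := exists_srcWeight_le (N := N) β s
    refine ⟨∏ _c : BlockIdx d M, K, fun U => ?_⟩
    rw [Finset.abs_prod]
    exact Finset.prod_le_prod (fun c _ => abs_nonneg _) fun c _ => hK _
  have hI0 : 0 ≤ I := integral_nonneg hF0
  have h1 : ENNReal.ofReal I ≤ (zl d N β ^ (d * (2 * M) ^ d - ((2 * M) ^ d - 1)))⁻¹ * zuJ N β s ^ #(freeEdges d (2 * M)) := by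
    rw [hI, ofReal_integral_wilsonMeasure β hFm hF0 hFb]
    calc (ZP d N (2 * M) β)⁻¹ * ∫⁻ U, ENNReal.ofReal (Real.exp (-β * wilsonAction ρN U)) *
          ENNReal.ofReal (∏ c : BlockIdx d M, srcWeight N β s (plaquetteHolonomy U (evenSite c) 0 (dTop d)))
          ∂Measure.pi (fun _ : Edge d (2 * M) => haarProbability (𝔾 N))
        ≤ (ZP d N (2 * M) β)⁻¹ * zuJ N β s ^ #(freeEdges d (2 * M)) := by
          refine mul_le_mul' le_rfl ?_
          calc ∫⁻ U, ENNReal.ofReal (Real.exp (-β * wilsonAction ρN U)) *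
                ENNReal.ofReal (∏ c : BlockIdx d M, srcWeight N β s (plaquetteHolonomy U (evenSite c) 0 (dTop d)))
                ∂Measure.pi (fun _ : Edge d (2 * M) => haarProbability (𝔾 N))
              = ∫⁻ U, (∏ c : BlockIdx d M, ENNReal.ofReal (srcWeight N β s (plaquetteHolonomy U (evenSite c) 0 (dTop d)))) *
                  ENNReal.ofReal (Real.exp (-β * wilsonAction ρN U))
                  ∂Measure.pi (fun _ : Edge d (2 * M) => haarProbability (𝔾 N)) :=
                lintegral_congr fun U => by
                  rw [mul_comm, ENNReal.ofReal_prod_of_nonneg fun c _ => (srcWeight_pos β s _).le]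
            _ ≤ _ := lintegral_torus_src_le hd hβ hs
      _ ≤ _ := mul_le_mul' (ENNReal.inv_le_inv.2 (zl_pow_le_ZP hβ)) le_rfl
  have hne : (zl d N β ^ (d * (2 * M) ^ d - ((2 * M) ^ d - 1)))⁻¹ * zuJ N β s ^ #(freeEdges d (2 * M)) ≠ ∞ :=
    ENNReal.mul_ne_top (ENNReal.inv_ne_top.2 (pow_ne_zero _ (zl_pos hβ).ne'))
      (ENNReal.pow_ne_top (zuJ_lt_top hβ s).ne)
  calc I = (ENNReal.ofReal I).toReal := (ENNReal.toReal_ofReal hI0).symm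
    _ ≤ ((zl d N β ^ (d * (2 * M) ^ d - ((2 * M) ^ d - 1)))⁻¹ * zuJ N β s ^ #(freeEdges d (2 * M))).toReal :=
        ENNReal.toReal_mono hne h1
    _ = (zuJ N β s).toReal ^ #(freeEdges d (2 * M)) / (zl d N β).toReal ^ (d * (2 * M) ^ d - ((2 * M) ^ d - 1)) := by
        rw [ENNReal.toReal_mul, ENNReal.toReal_inv, ENNReal.toReal_pow, ENNReal.toReal_pow, div_eq_inv_mul]

end TorusSource

/-! ## §6. The generating function `G_{r,Λ,a}(J^{(r)})`, Hölder, and THEOREM 4 (Gb) -/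

section GeneratingFunction

variable {L : ℕ} [NeZero L]

variable (N) in
/-- **The `r`-plaquette scaled field generating function** `G_{r,Λ,a}(J^{(r)}) = Z^P_{r,Λ,a}(J^{(r)})/Z^P_{Λ,a}`: the normalized
periodic Wilson expectation of the source factor `exp[Σ_{1≤j≤r} J_j tr M_{p_j}(U_{p_j})]`, for `r` plaquettes `p_j` of the torus
`(ℤ/Lℤ)^d` and source strengths `J_j` (complex numbers; the print's `J_j` are real), `U(N)`, coupling `β = 2a^{d−4}/g²`.
[cite: FariaDaVeigaOCarroll2022YMStability, §5 before Theorem 4 (chunk p0016)] -/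
def genFun (β : ℝ) {r : ℕ} (p : Fin r → Plaquette d L) (J : Fin r → ℂ) : ℂ :=
  ∫ U, Complex.exp (∑ j, J j * trM N β (plaquetteHolonomy U (p j).1 (p j).2.1.1 (p j).2.1.2)) ∂(wilsonMeasure ρN β)

/-- `G_{r,Λ,a}(J^{(r)}) = Z^P_{r,Λ,a}(J^{(r)}) / Z^P_{Λ,a}` with `Z^P_r(J) = ∫ exp[Σ_j J_j tr M_{p_j}] e^{−βS^P} dσ^E` the source-inserted
periodic partition function. [cite: FariaDaVeigaOCarroll2022YMStability, §5 before Theorem 4 (chunk p0016)] -/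
theorem genFun_eq_div (β : ℝ) {r : ℕ} (p : Fin r → Plaquette d L) (J : Fin r → ℂ) :
    genFun N β p J = (∫ U, Complex.exp (∑ j, J j * trM N β (plaquetteHolonomy U (p j).1 (p j).2.1.1 (p j).2.1.2))
      ∂(wilsonWeight (d := d) (L := L) ρN β)) / ((ZP d N L β).toReal : ℂ) := by
  rw [genFun, wilsonMeasure, integral_smul_measure, ENNReal.toReal_inv, Complex.real_smul, Complex.ofReal_inv,
    div_eq_inv_mul]

/-- **Generalized Hölder** (§6.5, first display: «`|G_{r,Λ,a}(J^{(r)})| ≤ ∏_{1≤j≤r} |G_{1,Λ,a}(rJ_j)|^{1/r}`», combined with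
«`|J tr M_p(U_p)| ≤ |J| [a^{(d−4)/2}/g] |tr(U_p − 1)|`»): `‖G_{r,Λ,a}(J)‖ ≤ ∏_j (∫ exp[r|J_j| γ^{1/2}|tr(U_{p_j} − 1)|] dμ^P)^{1/r}`.
[cite: FariaDaVeigaOCarroll2022YMStability, §6.5 (chunk p0019)] -/
theorem norm_genFun_le (β : ℝ) {r : ℕ} (p : Fin r → Plaquette d L) (J : Fin r → ℂ) :
    ‖genFun N β p J‖ ≤ ∏ j, (∫ U, srcWeight N β (r * ‖J j‖) (plaquetteHolonomy U (p j).1 (p j).2.1.1 (p j).2.1.2)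
      ∂(wilsonMeasure ρN β)) ^ ((1 : ℝ) / r) := by
  haveI := isProbabilityMeasure_wilsonMeasure (d := d) (L := L) ρN (continuous_unitaryFundamentalRep (Fin N) ℂ) β
  rcases Nat.eq_zero_or_pos r with hr | hr
  · subst hr
    simp [genFun]
  have hr' : (r : ℝ) ≠ 0 := by exact_mod_cast hr.ne'
  set μ := wilsonMeasure (d := d) (L := L) (G := 𝔾 N) ρN β with hμ
  -- the functions `f_j = exp[r|J_j|γ^{1/2}|tr(U_{p_j}−1)|]` and `a_j = f_j^{1/r}`
  set f : Fin r → GaugeConfig d L (𝔾 N) → ℝ := fun j U =>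
    srcWeight N β (r * ‖J j‖) (plaquetteHolonomy U (p j).1 (p j).2.1.1 (p j).2.1.2) with hf
  set a : Fin r → GaugeConfig d L (𝔾 N) → ℝ := fun j U =>
    srcWeight N β ‖J j‖ (plaquetteHolonomy U (p j).1 (p j).2.1.1 (p j).2.1.2) with ha
  have hfm : ∀ j, Measurable (f j) := fun j =>
    (continuous_srcWeight β _).measurable.comp (measurable_plaquetteHolonomy _ _ _)
  have ham : ∀ j, Measurable (a j) := fun j =>
    (continuous_srcWeight β _).measurable.comp (measurable_plaquetteHolonomy _ _ _)
  have hf0 : ∀ j U, 0 ≤ f j U := fun j U => (srcWeight_pos β _ _).le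
  have ha0 : ∀ j U, 0 ≤ a j U := fun j U => (srcWeight_pos β _ _).le
  have haf : ∀ j U, a j U = f j U ^ ((1 : ℝ) / r) := fun j U => by
    simp only [ha, hf, srcWeight, ← Real.exp_mul]
    congr 1
    field_simp
  -- Step 1: `‖G‖ ≤ ∫ ∏_j a_j dμ`
  have hprod_int : Integrable (fun U => ∏ j, a j U) μ := by
    refine integrable_of_bdd' ?_ (Finset.measurable_prod _ fun j _ => ham j)
    choose K hK using fun j => exists_srcWeight_le (N := N) β ‖J j‖
    refine ⟨∏ j, K j, fun U => ?_⟩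
    rw [Finset.abs_prod]
    exact Finset.prod_le_prod (fun j _ => abs_nonneg _) fun j _ => hK j _
  have step1 : ‖genFun N β p J‖ ≤ ∫ U, ∏ j, a j U ∂μ := by
    refine (norm_integral_le_integral_norm _).trans (integral_mono_of_nonneg (ae_of_all _ fun U => norm_nonneg _)
      hprod_int (ae_of_all _ fun U => ?_))
    dsimp only
    rw [Complex.norm_exp, Complex.re_sum]
    simp only [ha, srcWeight, ← Real.exp_sum]
    refine Real.exp_le_exp.2 (Finset.sum_le_sum fun j _ => ?_)
    calc (J j * trM N β (plaquetteHolonomy U (p j).1 (p j).2.1.1 (p j).2.1.2)).re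
        ≤ ‖J j * trM N β (plaquetteHolonomy U (p j).1 (p j).2.1.1 (p j).2.1.2)‖ := Complex.re_le_norm _
      _ = ‖J j‖ * (sqrtGamma β * ‖((plaquetteHolonomy U (p j).1 (p j).2.1.1 (p j).2.1.2 : 𝔾 N) : 𝕄).trace - N‖) := by
          rw [norm_mul, norm_trM]
  -- Step 2: Hölder in `ℝ≥0∞`
  have step2 : ∫⁻ U, ENNReal.ofReal (∏ j, a j U) ∂μ ≤ ∏ j, (ENNReal.ofReal (∫ U, f j U ∂μ)) ^ ((1 : ℝ) / r) := by
    have hsum : ∑ _j : Fin r, (1 : ℝ) / r = 1 := by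
      rw [Finset.sum_const, Finset.card_univ, Fintype.card_fin, nsmul_eq_mul]; field_simp
    calc ∫⁻ U, ENNReal.ofReal (∏ j, a j U) ∂μ
        = ∫⁻ U, ∏ j, ENNReal.ofReal (f j U) ^ ((1 : ℝ) / r) ∂μ := by
          refine lintegral_congr fun U => ?_
          rw [ENNReal.ofReal_prod_of_nonneg fun j _ => ha0 j U]
          refine Finset.prod_congr rfl fun j _ => ?_
          rw [haf, ENNReal.ofReal_rpow_of_nonneg (hf0 j U) (by positivity)]
      _ ≤ ∏ j, (∫⁻ U, ENNReal.ofReal (f j U) ∂μ) ^ ((1 : ℝ) / r) :=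
          ENNReal.lintegral_prod_norm_pow_le _ (fun j _ => (ENNReal.measurable_ofReal.comp (hfm j)).aemeasurable) hsum
            fun j _ => by positivity
      _ = ∏ j, (ENNReal.ofReal (∫ U, f j U ∂μ)) ^ ((1 : ℝ) / r) := by
          refine Finset.prod_congr rfl fun j _ => ?_
          rw [ofReal_integral_eq_lintegral_ofReal (integrable_of_bdd' ?_ (hfm j)) (ae_of_all _ (hf0 j))]
          obtain ⟨K, hK⟩ := exists_srcWeight_le (N := N) β (r * ‖J j‖)
          exact ⟨K, fun U => hK _⟩
  -- Step 3: back to real numbers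
  have hne : ∏ j, (ENNReal.ofReal (∫ U, f j U ∂μ)) ^ ((1 : ℝ) / r) ≠ ∞ :=
    ENNReal.prod_ne_top fun j _ => ENNReal.rpow_ne_top_of_nonneg (by positivity) ENNReal.ofReal_ne_top
  calc ‖genFun N β p J‖ ≤ ∫ U, ∏ j, a j U ∂μ := step1
    _ = (∫⁻ U, ENNReal.ofReal (∏ j, a j U) ∂μ).toReal :=
        integral_eq_lintegral_of_nonneg_ae (ae_of_all _ fun U => Finset.prod_nonneg fun j _ => ha0 j U)
          hprod_int.aestronglyMeasurable
    _ ≤ (∏ j, (ENNReal.ofReal (∫ U, f j U ∂μ)) ^ ((1 : ℝ) / r)).toReal := ENNReal.toReal_mono hne step2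
    _ = ∏ j, (∫ U, f j U ∂μ) ^ ((1 : ℝ) / r) := by
        rw [ENNReal.toReal_prod]
        refine Finset.prod_congr rfl fun j _ => ?_
        rw [← ENNReal.toReal_rpow, ENNReal.toReal_ofReal (integral_nonneg (hf0 j))]

/-- **THEOREM 4, first item (Gb)**: for the periodic `U(N)` Wilson model on the torus `(ℤ/Lℤ)^d`, `d ≥ 2`, `L = 2M` with `M`
even, every `β = 2a^{d−4}/g² ≥ 0`, every `r`, every family of plaquettes `p_1, …, p_r` and all source strengths `J_1, …, J_r`,
`|G_{r,Λ,a}(J^{(r)})| ≤ ∏_{1≤j≤r} ( |z_u(rJ_j)|^{Λ_r} / z_ℓ^{Λ_r+Λ_e} )^{2^d/(rΛ_s)}` — the print's `∏_j |z_u(rJ_j)|^{2^dΛ_r/(rΛ_s)}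
z_ℓ^{−2^d(Λ_r+Λ_e)/(rΛ_s)}` with `Λ_s = L^d` (so `2^d/Λ_s = 1/M^d`), `Λ_r = #E^1_L` the retained bonds and `Λ_r + Λ_e = dL^d − (L^d
− 1)` the non-gauged bonds of the periodic model; `|z_u(J)|` = (Gb2) line 1 (`zuJ`) and `z_ℓ` = (zl) in the Frobenius currency
of `FdVOC22StabilityBounds`.  Proof as printed (§6.5): generalized Hölder (`norm_genFun_le`), lattice symmetry
(`integral_plaquette_eq_of_symmetry`), the multi-reflection bound (`integral_plaquette_le_rpow_of_one_le`), sources on all partner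
plaquettes and the successive bond integrations (`integral_prod_srcWeight_le`), and `z_ℓ^{Λ_r+Λ_e} ≤ Z^P` (`zl_pow_le_ZP`).
[cite: FariaDaVeigaOCarroll2022YMStability, Theorem 4 (Gb) (chunk p0016); proof §6.5 (p0019)] -/
theorem theorem4_generating_function_bound [NeZero d] (hd : 2 ≤ d) {M : ℕ} [NeZero M] (hM : Even M) {β : ℝ} (hβ : 0 ≤ β)
    {r : ℕ} (p : Fin r → Plaquette d (2 * M)) (J : Fin r → ℂ) :
    ‖genFun N β p J‖ ≤ ∏ j, ((zuJ N β (r * ‖J j‖)).toReal ^ #(freeEdges d (2 * M)) /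
        (zl d N β).toReal ^ (d * (2 * M) ^ d - ((2 * M) ^ d - 1))) ^ ((1 : ℝ) / (r * (M : ℝ) ^ d)) := by
  have hρ := continuous_unitaryFundamentalRep (Fin N) ℂ
  refine (norm_genFun_le β p J).trans (Finset.prod_le_prod
    (fun j _ => Real.rpow_nonneg (integral_nonneg fun U => (srcWeight_pos β _ _).le) _) fun j _ => ?_)
  set s : ℝ := r * ‖J j‖ with hs_def
  have hs : 0 ≤ s := by positivity
  set B : ℝ := (zuJ N β s).toReal ^ #(freeEdges d (2 * M)) / (zl d N β).toReal ^ (d * (2 * M) ^ d - ((2 * M) ^ d - 1))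
    with hB
  have hB0 : 0 ≤ B := by positivity
  -- move the plaquette `p_j` to the reference block plaquette, then the chessboard bound
  have hsymm : ∫ U, srcWeight N β s (plaquetteHolonomy U (p j).1 (p j).2.1.1 (p j).2.1.2) ∂(wilsonMeasure ρN β) =
      ∫ U, srcWeight N β s (plaquetteHolonomy U (blockSite (0 : BlockIdx d M)) 0 (dTop d)) ∂(wilsonMeasure ρN β) :=
    integral_plaquette_eq_of_symmetry ρN hρ β (srcWeight N β s) (p j).1 (blockSite (0 : BlockIdx d M))
      (ne_of_lt (p j).2.2) (dTop_ne_zero hd)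
  have hI0 : 0 ≤ ∫ U, ∏ c : BlockIdx d M, srcWeight N β s (plaquetteHolonomy U (blockSite c) 0 (dTop d))
      ∂(wilsonMeasure ρN β) :=
    integral_nonneg fun U => Finset.prod_nonneg fun c _ => (srcWeight_pos β s _).le
  have hchess : ∫ U, srcWeight N β s (plaquetteHolonomy U (blockSite (0 : BlockIdx d M)) 0 (dTop d)) ∂(wilsonMeasure ρN β)
      ≤ B ^ ((1 : ℝ) / (M : ℝ) ^ d) :=
    (integral_plaquette_le_rpow_of_one_le ρN hM hρ hβ (dTop_ne_zero hd) (one_le_srcWeight β hs)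
      (exists_srcWeight_le β s)
      (fun x p' q' => (continuous_srcWeight β s).measurable.comp (measurable_plaquetteHolonomy _ _ _))
      (srcWeight_conj β s) (srcWeight_inv β s) 0).trans
      (Real.rpow_le_rpow hI0 (integral_prod_srcWeight_le hd hβ hs) (by positivity))
  have hsymm0 : 0 ≤ ∫ U, srcWeight N β s (plaquetteHolonomy U (p j).1 (p j).2.1.1 (p j).2.1.2) ∂(wilsonMeasure ρN β) :=
    integral_nonneg fun U => (srcWeight_pos β s _).le
  calc (∫ U, srcWeight N β s (plaquetteHolonomy U (p j).1 (p j).2.1.1 (p j).2.1.2) ∂(wilsonMeasure ρN β)) ^ ((1 : ℝ) / r)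
      ≤ (B ^ ((1 : ℝ) / (M : ℝ) ^ d)) ^ ((1 : ℝ) / r) :=
        Real.rpow_le_rpow hsymm0 (hsymm ▸ hchess) (by positivity)
    _ = B ^ ((1 : ℝ) / (r * (M : ℝ) ^ d)) := by
        rw [← Real.rpow_mul hB0]
        congr 1
        rw [one_div_mul_one_div, mul_comm]

/-- **THEOREM 4 (Gb) with the printed exponents**: `|G_{r,Λ,a}(J^{(r)})| ≤ ∏_{1≤j≤r} |z_u(rJ_j)|^{2^dΛ_r/(rΛ_s)}
z_ℓ^{−2^d(Λ_r+Λ_e)/(rΛ_s)}` with `Λ_s = L^d` the number of sites, `Λ_r = #E^1_L`, `Λ_r + Λ_e = dL^d − (L^d − 1)`, `L = 2M`, `M` even,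
`d ≥ 2`, `β ≥ 0` (real powers; `2^d/Λ_s = 1/M^d`). [cite: FariaDaVeigaOCarroll2022YMStability, Theorem 4 (Gb) (chunk p0016); proof §6.5 (p0019)] -/
theorem theorem4_generating_function_bound_printed [NeZero d] (hd : 2 ≤ d) {M : ℕ} [NeZero M] (hM : Even M) {β : ℝ}
    (hβ : 0 ≤ β) {r : ℕ} (p : Fin r → Plaquette d (2 * M)) (J : Fin r → ℂ) :
    ‖genFun N β p J‖ ≤ ∏ j,
      (zuJ N β (r * ‖J j‖)).toReal ^ ((2 : ℝ) ^ d * (#(freeEdges d (2 * M)) : ℝ) / (r * ((2 * M : ℕ) : ℝ) ^ d)) *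
        (zl d N β).toReal ^ (-((2 : ℝ) ^ d * ((d * (2 * M) ^ d - ((2 * M) ^ d - 1) : ℕ) : ℝ) / (r * ((2 * M : ℕ) : ℝ) ^ d))) := by
  refine (theorem4_generating_function_bound hd hM hβ p J).trans (le_of_eq (Finset.prod_congr rfl fun j _ => ?_))
  have hx : 0 ≤ (zuJ N β (r * ‖J j‖)).toReal := ENNReal.toReal_nonneg
  have hy : 0 < (zl d N β).toReal :=
    ENNReal.toReal_pos (zl_pos hβ).ne' ((zl_le_one hβ).trans_lt ENNReal.one_lt_top).ne
  have hM0 : (M : ℝ) ≠ 0 := by exact_mod_cast (NeZero.ne M)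
  have hΛs : ((2 * M : ℕ) : ℝ) ^ d = (2 : ℝ) ^ d * (M : ℝ) ^ d := by push_cast; ring
  have hexp : ∀ t : ℝ, (2 : ℝ) ^ d * t / (r * ((2 * M : ℕ) : ℝ) ^ d) = t * ((1 : ℝ) / (r * (M : ℝ) ^ d)) := fun t => by
    rw [hΛs]
    rcases Nat.eq_zero_or_pos r with hr | hr
    · subst hr; simp
    · field_simp
  rw [hexp, hexp, Real.rpow_neg hy.le, Real.div_rpow (pow_nonneg hx _) (pow_nonneg hy.le _),
    Real.rpow_mul hx, Real.rpow_mul hy.le, Real.rpow_natCast, Real.rpow_natCast, div_eq_mul_inv]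

end GeneratingFunction

end FariaDaVeigaOCarroll2022

end Literature.MathematicalPhysics.QuantumFieldTheory
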